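import Summits.AtomisticToContinuum.BoseEinsteinCondensation.Theorems.DensityResponse.Negative.FreeChord

/-!
# Negative lemmas for crux `DensityResponse` (stmt-AtomisticToContinuum-9481), VI: `n ≠ 0` is
# load-bearing; the `η`-modulated orbital

Supports (does not close) stmt-AtomisticToContinuum-9481 (route `BECThomsonPrinciple`, rank 4); landed
copy of §10–§11a of `Cruxes/DensityResponse/Disproof.lean` (generation 2); `sorry`-free, standard axioms.

* §10 `densityResponse_false_without_modeNeZero : ¬ DensityResponseWithoutModeNeZero` (gen 1 (a),
  importable): with the hypothesis `n ≠ 0` deleted the crux fails at `n = 0` already for the free gas —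
  the source is `2N`, the bound's denominator `k∞² + ρ·a(0)` vanishes and `x/0 = 0`; constant state,
  `s = 1`.  (`densityResponse_of_withoutModeNeZero`: the variant is the crux minus that hypothesis.)
* §11a the one-parameter orbital `φ_{η,L} = c_η(1 + 2η cos(2πx₀/L))` of the tightness family: smooth,
  periodic, exact derivative (`fderiv_orbη_single`), cell integrals `∫|φ|² = 1`, `∫2cos θ|φ|² = 4η/(1+2η²)`,
  `∫|∂₀φ|² = 2η²(2π/L)²/(1+2η²)`.
-/

noncomputable section

open MeasureTheory Set Filter Metric
open scoped ENNReal NNReal BigOperators Classical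

namespace Summit.AtomisticToContinuum.BoseEinsteinCondensation.Theorems.DensityResponse.Negative

open Literature.MathematicalPhysics.QuantumManyBody.BoseGas

section ModeZero

variable {N : ℕ} {L : ℝ}

/-- The free energy of the constant state vanishes. [folklore] -/
theorem periodicEnergy_zero_constState (N : ℕ) (hL : 0 < L) : periodicEnergy 0 (constState N hL) = 0 := by
  rw [periodicEnergy_zero_eq]
  refine (lintegral_congr fun X => ?_).trans lintegral_zero
  simp [constState, kineticDensity]

/-- **`DensityResponse` with the hypothesis `n ≠ 0` deleted** (everything else verbatim).  A variant
STATEMENT of this file, refuted below (untagged on purpose). -/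
def DensityResponseWithoutModeNeZero : Prop :=
  ∀ v : ℝ → ℝ≥0∞, IsRepulsiveFiniteRange v → ∀ M : ℝ, 0 < M → ∃ ρ₀ C : ℝ, 0 < ρ₀ ∧ 0 < C ∧
    ∃ N₀ : ℕ, ∀ N : ℕ, N₀ ≤ N → ∀ L : ℝ, 0 < L → (N : ℝ) ≤ ρ₀ * L ^ 3 → ∀ n : Fin 3 → ℤ,
    2 * Real.pi * ‖(fun j => (n j : ℝ))‖ / L ≤ M * Real.sqrt (N / L ^ 3) → ∀ s : ℝ, 0 ≤ s →
    ∀ Φ : PeriodicTrialState N L,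
      periodicGroundStateEnergy v N L + ENNReal.ofReal (s * |∫ X in cellN N L,
        (∑ i, 2 * Real.cos (2 * Real.pi / L * ∑ j, (n j : ℝ) * X i j)) * ‖Φ.ψ X‖ ^ 2|) ≤
      periodicEnergy v Φ + ENNReal.ofReal (C * s ^ 2 * N /
        ((2 * Real.pi * ‖(fun j => (n j : ℝ))‖ / L) ^ 2 + N / L ^ 3 * (scatteringLength v).toReal))

/-- The deleted hypothesis only weakens: the variant implies the crux. [folklore] -/
theorem densityResponse_of_withoutModeNeZero (h : DensityResponseWithoutModeNeZero) :
    Summit.AtomisticToContinuum.BoseEinsteinCondensation.Theses.BECThomsonPrinciple.DensityResponse := by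
  intro v hv M hM
  obtain ⟨ρ₀, C, hρ₀, hC, N₀, H⟩ := h v hv M hM
  exact ⟨ρ₀, C, hρ₀, hC, N₀, fun N hN L hL hd n _ hw s hs Φ => H N hN L hL hd n hw s hs Φ⟩

/-- **`n ≠ 0` is load-bearing** (gen 1 (a)): at `n = 0` the "source" is the particle number,
`⟨Σᵢ 2cos 0⟩ = 2N`, while for the free gas the bound's denominator `k∞² + ρ·a(0)` vanishes and
Lean's `x/0 = 0` kills the right-hand side: the constant state violates the chord at `s = 1`.
(Physically: a uniform potential shift `-2sN` is not a density response.) [folklore] -/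
theorem densityResponse_false_without_modeNeZero : ¬ DensityResponseWithoutModeNeZero := by
  intro H
  obtain ⟨ρ₀, C, hρ₀, -, N₀, H⟩ := H 0 ⟨measurable_const, 0, fun _ _ => rfl⟩ 1 one_pos
  obtain ⟨N, hN0, hN1⟩ : ∃ N : ℕ, N₀ ≤ N ∧ 1 ≤ N := ⟨max N₀ 1, le_max_left _ _, le_max_right _ _⟩
  set L : ℝ := max 1 (N / ρ₀) with hL_def
  have hL1 : 1 ≤ L := le_max_left _ _
  have hL : 0 < L := by linarith
  have hdil : (N : ℝ) ≤ ρ₀ * L ^ 3 := by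
    have h1 : (N : ℝ) / ρ₀ ≤ L := le_max_right _ _
    have h2 : (N : ℝ) ≤ ρ₀ * L := by rwa [div_le_iff₀' hρ₀] at h1
    have h3 : L ≤ L ^ 3 := by
      have : 1 ≤ L ^ 2 := by nlinarith
      nlinarith
    nlinarith
  have hwin : 2 * Real.pi * ‖(fun j => ((0 : Fin 3 → ℤ) j : ℝ))‖ / L ≤ 1 * Real.sqrt (N / L ^ 3) := by
    have : (fun j => ((0 : Fin 3 → ℤ) j : ℝ)) = 0 := by funext j; simp
    rw [this, norm_zero, mul_zero, zero_div]
    positivity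
  have key := H N hN0 L hL hdil 0 hwin 1 zero_le_one (constState N hL)
  have hsrc : ∫ X in cellN N L, (∑ i, 2 * Real.cos (2 * Real.pi / L * ∑ j, ((0 : Fin 3 → ℤ) j : ℝ) * X i j)) *
      ‖(constState N hL).ψ X‖ ^ 2 = 2 * N := by
    have : ∀ X : Config N, (∑ i, 2 * Real.cos (2 * Real.pi / L * ∑ j, ((0 : Fin 3 → ℤ) j : ℝ) * X i j)) *
        ‖(constState N hL).ψ X‖ ^ 2 = 2 * N * ‖(constState N hL).ψ X‖ ^ 2 := by
      intro X; simp [mul_comm]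
    simp_rw [this]
    rw [integral_const_mul, integral_cellN_norm_sq, mul_one]
  have hden : (2 * Real.pi * ‖(fun j => ((0 : Fin 3 → ℤ) j : ℝ))‖ / L) ^ 2 +
      N / L ^ 3 * (scatteringLength 0).toReal = 0 := by
    have : (fun j => ((0 : Fin 3 → ℤ) j : ℝ)) = 0 := by funext j; simp
    rw [this, norm_zero, scatteringLength_zero]
    simp
  rw [hsrc, hden, div_zero, ENNReal.ofReal_zero, add_zero, periodicEnergy_zero_constState,
    periodicGroundStateEnergy_zero N hL, zero_add, one_mul, abs_of_nonneg (by positivity),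
    nonpos_iff_eq_zero, ENNReal.ofReal_eq_zero] at key
  have : (0 : ℝ) < 2 * N := by positivity
  linarith

end ModeZero

section Tightness

variable {N : ℕ} {L : ℝ}

/-- The profile `1 + 2η cos θ`. [folklore] -/
def profη (η L : ℝ) (x : Space) : ℝ := 1 + 2 * η * Real.cos (θL L x)

/-- The normalisation `c_η = (L³(1+2η²))^{-1/2}`. [folklore] -/
def cη (η L : ℝ) : ℝ := (Real.sqrt ((1 + 2 * η ^ 2) * L ^ 3))⁻¹

/-- The orbital `φ_{η,L} = c_η (1 + 2η cos θ)`. [folklore] -/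
def orbη (η L : ℝ) (x : Space) : ℂ := ((cη η L * profη η L x : ℝ) : ℂ)

/-- `c_η > 0`. [folklore] -/
theorem cη_pos (η : ℝ) (hL : 0 < L) : 0 < cη η L := by
  unfold cη; positivity

/-- `c_η² = 1/((1+2η²)L³)`. [folklore] -/
theorem cη_sq (η : ℝ) (hL : 0 < L) : cη η L ^ 2 = 1 / ((1 + 2 * η ^ 2) * L ^ 3) := by
  unfold cη
  rw [inv_pow, Real.sq_sqrt (by positivity), one_div]

/-- The profile is smooth. [folklore] -/
theorem contDiff_profη (η L : ℝ) : ContDiff ℝ ⊤ (profη η L) := by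
  unfold profη θL; fun_prop

/-- The orbital is smooth. [folklore] -/
theorem contDiff_orbη (η L : ℝ) : ContDiff ℝ ⊤ (orbη η L) := by
  have : orbη η L = fun x => Complex.ofRealCLM (cη η L * profη η L x) := by
    funext x; rw [Complex.ofRealCLM_apply]; rfl
  rw [this]
  exact Complex.ofRealCLM.contDiff.comp (contDiff_const.mul (contDiff_profη η L))

/-- The orbital is continuous. [folklore] -/
theorem continuous_orbη (η L : ℝ) : Continuous (orbη η L) := (contDiff_orbη η L).continuous

/-- `|φ_{η,L}|² = c_η²(1+2η cos θ)²`. [folklore] -/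
theorem norm_orbη_sq (η : ℝ) (L : ℝ) (x : Space) : ‖orbη η L x‖ ^ 2 = cη η L ^ 2 * profη η L x ^ 2 := by
  unfold orbη
  rw [Complex.norm_real, Real.norm_eq_abs, sq_abs, mul_pow]

/-- `φ_{η,L}` is `L`-periodic. [folklore] -/
theorem orbη_periodic (η : ℝ) (hL : L ≠ 0) (x : Space) (k : Fin 3) :
    orbη η L (x + EuclideanSpace.single k L) = orbη η L x := by
  have hθ : Real.cos (θL L (x + EuclideanSpace.single k L)) = Real.cos (θL L x) := by
    unfold θL
    simp only [PiLp.add_apply, PiLp.single_apply]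
    split_ifs
    · rw [mul_add, div_mul_cancel₀ _ hL, Real.cos_add_two_pi]
    · rw [add_zero]
  unfold orbη profη
  rw [hθ]

/-- The derivative of the profile. [folklore] -/
theorem hasFDerivAt_profη (η L : ℝ) (x : Space) :
    HasFDerivAt (profη η L)
      ((2 * η : ℝ) • (-Real.sin (θL L x) •
        ((2 * Real.pi / L) • EuclideanSpace.proj (𝕜 := ℝ) (0 : Fin 3)))) x := by
  have h0 : HasFDerivAt (fun y : Space => θL L y)
      ((2 * Real.pi / L) • EuclideanSpace.proj (𝕜 := ℝ) (0 : Fin 3)) x :=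
    ((EuclideanSpace.proj (𝕜 := ℝ) (0 : Fin 3)).hasFDerivAt).const_mul (2 * Real.pi / L)
  exact ((h0.cos).const_mul (2 * η)).const_add 1

/-- The derivative of the orbital. [folklore] -/
theorem hasFDerivAt_orbη (η L : ℝ) (x : Space) :
    HasFDerivAt (orbη η L) (Complex.ofRealCLM.comp (cη η L • ((2 * η : ℝ) • (-Real.sin (θL L x) •
        ((2 * Real.pi / L) • EuclideanSpace.proj (𝕜 := ℝ) (0 : Fin 3)))))) x := by
  have h1 := (hasFDerivAt_profη η L x).const_mul (cη η L)
  have h2 := Complex.ofRealCLM.hasFDerivAt.comp x h1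
  have : orbη η L = fun y => Complex.ofRealCLM (cη η L * profη η L y) := by
    funext y; rw [Complex.ofRealCLM_apply]; rfl
  rw [this]
  exact h2

/-- `∂_k φ_{η,L}(x) = -c_η 2η (2π/L) sin θ · [k = 0]`. [folklore] -/
theorem fderiv_orbη_single (η L : ℝ) (x : Space) (k : Fin 3) :
    fderiv ℝ (orbη η L) x (EuclideanSpace.single k (1 : ℝ)) =
      ((cη η L * (2 * η * (-Real.sin (θL L x) * (2 * Real.pi / L * if (0 : Fin 3) = k then 1 else 0))) : ℝ) : ℂ) := by
  rw [(hasFDerivAt_orbη η L x).fderiv, ContinuousLinearMap.comp_apply, Complex.ofRealCLM_apply]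
  congr 1
  simp only [smul_apply, smul_eq_mul, euclideanProj_apply, PiLp.single_apply]

/-- `|∂₀ φ_{η,L}(x)|² = c_η² 4η² (2π/L)² sin²θ` and `∂_k φ_{η,L} = 0` for `k ≠ 0`. [folklore] -/
theorem norm_fderiv_orbη_single_zero_sq (η L : ℝ) (x : Space) :
    ‖fderiv ℝ (orbη η L) x (EuclideanSpace.single 0 (1 : ℝ))‖ ^ 2 =
      cη η L ^ 2 * (4 * η ^ 2 * (2 * Real.pi / L) ^ 2) * Real.sin (θL L x) ^ 2 := by
  rw [fderiv_orbη_single, if_pos rfl, Complex.norm_real, Real.norm_eq_abs, sq_abs]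
  ring

/-- `∂_k φ_{η,L} = 0` for `k ≠ 0`. [folklore] -/
theorem fderiv_orbη_single_of_ne (η L : ℝ) (x : Space) {k : Fin 3} (hk : (0 : Fin 3) ≠ k) :
    fderiv ℝ (orbη η L) x (EuclideanSpace.single k (1 : ℝ)) = 0 := by
  rw [fderiv_orbη_single, if_neg hk]
  simp

/-! ### Cell integrals of the `η`-orbital -/

/-- `(1+2η cos θ)²` in cosines of multiples. [folklore] -/
theorem profη_sq_eq (η L : ℝ) (x : Space) :
    profη η L x ^ 2 = (1 + 2 * η ^ 2) + 4 * η * Real.cos ((1 : ℤ) * θL L x) +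
      2 * η ^ 2 * Real.cos ((2 : ℤ) * θL L x) := by
  unfold profη
  push_cast
  rw [one_mul, Real.cos_two_mul]
  ring

/-- `2cos θ(1+2η cos θ)²` in cosines of multiples. [folklore] -/
theorem two_cos_mul_profη_sq_eq (η L : ℝ) (x : Space) :
    2 * Real.cos (θL L x) * profη η L x ^ 2 = 4 * η + (2 + 6 * η ^ 2) * Real.cos ((1 : ℤ) * θL L x) +
      4 * η * Real.cos ((2 : ℤ) * θL L x) + 2 * η ^ 2 * Real.cos ((3 : ℤ) * θL L x) := by
  unfold profη
  push_cast
  rw [one_mul, Real.cos_two_mul, Real.cos_three_mul]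
  ring

/-- `sin²θ = ½ − ½cos 2θ`. [folklore] -/
theorem sin_sq_eq (L : ℝ) (x : Space) :
    Real.sin (θL L x) ^ 2 = 1 / 2 - 1 / 2 * Real.cos ((2 : ℤ) * θL L x) := by
  push_cast
  rw [Real.sin_sq, Real.cos_sq]
  ring

/-- `∫_cell (1 + 2η cos θ)² = (1 + 2η²) L³`. [folklore] -/
theorem integral_cell_profη_sq (η : ℝ) (hL : 0 < L) :
    ∫ x in cell L, profη η L x ^ 2 = (1 + 2 * η ^ 2) * L ^ 3 := by
  simp_rw [profη_sq_eq]
  have hc : IntegrableOn (fun _ : Space => (1 + 2 * η ^ 2 : ℝ)) (cell L) := integrableOn_const (volume_cell_ne_top L)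
  have h1 := (integrableOn_cell_cos L 1).const_mul (4 * η)
  have h2 := (integrableOn_cell_cos L 2).const_mul (2 * η ^ 2)
  rw [integral_add (hc.fun_add h1) h2, integral_add hc h1, integral_const_mul, integral_const_mul,
    integral_cell_cos hL one_ne_zero, integral_cell_cos hL two_ne_zero,
    setIntegral_const, volume_real_cell hL.le, smul_eq_mul]
  ring

/-- `∫_cell 2cos θ (1 + 2η cos θ)² = 4η L³`. [folklore] -/
theorem integral_cell_two_cos_profη_sq (η : ℝ) (hL : 0 < L) :
    ∫ x in cell L, 2 * Real.cos (θL L x) * profη η L x ^ 2 = 4 * η * L ^ 3 := by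
  simp_rw [two_cos_mul_profη_sq_eq]
  have hc : IntegrableOn (fun _ : Space => (4 * η : ℝ)) (cell L) := integrableOn_const (volume_cell_ne_top L)
  have h1 := (integrableOn_cell_cos L 1).const_mul (2 + 6 * η ^ 2)
  have h2 := (integrableOn_cell_cos L 2).const_mul (4 * η)
  have h3 := (integrableOn_cell_cos L 3).const_mul (2 * η ^ 2)
  rw [integral_add ((hc.fun_add h1).fun_add h2) h3, integral_add (hc.fun_add h1) h2, integral_add hc h1,
    setIntegral_const, integral_const_mul, integral_const_mul, integral_const_mul,
    integral_cell_cos hL one_ne_zero, integral_cell_cos hL two_ne_zero, integral_cell_cos hL (by norm_num),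
    volume_real_cell hL.le, smul_eq_mul]
  ring

/-- `∫_cell sin²θ = L³/2`. [folklore] -/
theorem integral_cell_sin_sq (hL : 0 < L) : ∫ x in cell L, Real.sin (θL L x) ^ 2 = L ^ 3 / 2 := by
  simp_rw [sin_sq_eq]
  have hc : IntegrableOn (fun _ : Space => (1 / 2 : ℝ)) (cell L) := integrableOn_const (volume_cell_ne_top L)
  have h2 := (integrableOn_cell_cos L 2).const_mul (1 / 2)
  rw [integral_sub hc h2, integral_const_mul, integral_cell_cos hL two_ne_zero, setIntegral_const,
    volume_real_cell hL.le, smul_eq_mul]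
  ring

/-- **Normalisation** `∫_cell |φ_{η,L}|² = 1`. [folklore] -/
theorem integral_cell_norm_orbη_sq (η : ℝ) (hL : 0 < L) : ∫ x in cell L, ‖orbη η L x‖ ^ 2 = 1 := by
  simp_rw [norm_orbη_sq]
  rw [integral_const_mul, integral_cell_profη_sq η hL, cη_sq η hL]
  field_simp

/-- **Source** `∫_cell 2cos θ |φ_{η,L}|² = 4η/(1+2η²)`. [folklore] -/
theorem integral_cell_two_cos_norm_orbη_sq (η : ℝ) (hL : 0 < L) :
    ∫ x in cell L, 2 * Real.cos (θL L x) * ‖orbη η L x‖ ^ 2 = 4 * η / (1 + 2 * η ^ 2) := by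
  simp_rw [norm_orbη_sq]
  have : ∀ x, 2 * Real.cos (θL L x) * (cη η L ^ 2 * profη η L x ^ 2) =
      cη η L ^ 2 * (2 * Real.cos (θL L x) * profη η L x ^ 2) := fun x => by ring
  simp_rw [this]
  rw [integral_const_mul, integral_cell_two_cos_profη_sq η hL, cη_sq η hL]
  field_simp

/-- **Directional kinetic energy of the orbital** `∫_cell |∂₀ φ_{η,L}|² = 2η²(2π/L)²/(1+2η²)`.
[folklore] -/
theorem integral_cell_norm_fderiv_orbη_sq (η : ℝ) (hL : 0 < L) :
    ∫ x in cell L, ‖fderiv ℝ (orbη η L) x (EuclideanSpace.single 0 (1 : ℝ))‖ ^ 2 =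
      2 * η ^ 2 * (2 * Real.pi / L) ^ 2 / (1 + 2 * η ^ 2) := by
  simp_rw [norm_fderiv_orbη_single_zero_sq]
  rw [integral_const_mul, integral_cell_sin_sq hL, cη_sq η hL]
  field_simp
  ring

/-- `|φ_{η,L}| ≤ c_η(1+2|η|)`. [folklore] -/
theorem norm_orbη_le (η : ℝ) (hL : 0 < L) (x : Space) : ‖orbη η L x‖ ≤ cη η L * (1 + 2 * |η|) := by
  unfold orbη
  rw [Complex.norm_real, Real.norm_eq_abs, abs_mul, abs_of_pos (cη_pos η hL)]
  refine mul_le_mul_of_nonneg_left ?_ (cη_pos η hL).le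
  unfold profη
  calc |1 + 2 * η * Real.cos (θL L x)| ≤ |(1 : ℝ)| + |2 * η * Real.cos (θL L x)| := abs_add_le _ _
    _ ≤ 1 + 2 * |η| := by
        rw [abs_one, abs_mul, abs_mul, abs_two]
        have := Real.abs_cos_le_one (θL L x)
        nlinarith [abs_nonneg η]

/-- `|φ_{η,L}|²` is integrable on the cell. [folklore] -/
theorem integrableOn_cell_norm_orbη_sq (η : ℝ) (hL : 0 < L) :
    IntegrableOn (fun x => ‖orbη η L x‖ ^ 2) (cell L) := by
  refine integrableOn_cell_of_bound (g := fun x => ‖orbη η L x‖ ^ 2) ((continuous_orbη η L).norm.pow 2)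
    (M := (cη η L * (1 + 2 * |η|)) ^ 2) (fun x => ?_) L
  rw [Real.norm_eq_abs, abs_of_nonneg (sq_nonneg _)]
  exact pow_le_pow_left₀ (norm_nonneg _) (norm_orbη_le η hL x) 2

/-- Normalisation in `ℝ≥0∞`. [folklore] -/
theorem lintegral_cell_orbη_sq (η : ℝ) (hL : 0 < L) :
    ∫⁻ x in cell L, (‖orbη η L x‖₊ : ℝ≥0∞) ^ 2 = 1 := by
  simp_rw [ennnorm_sq_eq]
  rw [← ofReal_integral_eq_lintegral_ofReal (integrableOn_cell_norm_orbη_sq η hL)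
    (ae_of_all _ fun x => by positivity), integral_cell_norm_orbη_sq η hL, ENNReal.ofReal_one]

/-- `|φ_{η,L}|²` is measurable. [folklore] -/
theorem measurable_orbη_sq (η L : ℝ) : Measurable fun x => (‖orbη η L x‖₊ : ℝ≥0∞) ^ 2 :=
  ((continuous_orbη η L).measurable.nnnorm.coe_nnreal_ennreal).pow_const 2


end Tightness

end Summit.AtomisticToContinuum.BoseEinsteinCondensation.Theorems.DensityResponse.Negative

end
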